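import Literature.MathematicalPhysics.QuantumLattice.TorusSectorGibbsOpenBoxBound
import Literature.MathematicalPhysics.QuantumLattice.PairFieldMomentum
import HarnessLib

/-!
# Canonical partition functions are bounded by the grand-canonical one: `e^{βμN} Z_β(A; a, b) ≤ Z_β(A − μN)`

Family `hubbard` (topic `MathematicalPhysics/QuantumLattice`; companion of `SectorPartitionFnCut`,
`TorusSectorGibbsOpenBoxBound`). The free-energy route of the `T > 0` certificate family needs, besides the
canonical free-energy UPPER bounds produced by `TorusSectorPartitionFnTiling`, a free-energy LOWER bound at a
hotter temperature (`log Z ≤ u_h L²`, hypothesis `huh` of the hot chord). The available high-temperature /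
cluster-expansion controls of the Hubbard pressure (`HubbardLatticeAnalytic`, `HubbardPolymerBounds`,
`HubbardTorusSingleScalePressure`) are GRAND-CANONICAL (`hamiltonianWith G t U μ = H − μN`,
`hubbardTorusWith`). This file supplies the one-line bridge: for a Hermitian, sector-preserving `A`, every
real `β, μ` and every spin sector `(a, b)`,

  `e^{βμ(a+b)} · Re Z_β(A; a, b) ≤ Re Z_β(A − μN)`      (`exp_mul_partitionFn_spinSector_le_grandCanonical`)

(Peierls' inequality for the sector eigenbasis, on which `N = a + b`), hence
`log Re Z_β(A; a, b) ≤ log Re Z_β(A − μN) − βμ(a+b)` (`log_partitionFn_spinSector_le_grandCanonical`) and, in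
the torus-limit thermal convention, `log Re Z_β(sectorHamiltonianTT' t t' U n L) ≤
log Re Z_β(hubbardTorusTT' L t t' U − μN) − βμ·rectN n L` (`log_partitionFn_sectorHamiltonianTT'_le_grandCanonical`):
any certified upper bound on the grand-canonical torus pressure at `β_h` (any `μ`) is a valid `u_h`.
Everything is PROVED; no definition, no named fact.

## References

* D. Ruelle, *Statistical Mechanics: Rigorous Results* (1969), §3.4 (canonical vs grand-canonical ensembles:
  `Ξ(μ) = Σ_N e^{βμN} Z_N ≥ e^{βμN} Z_N`). [cite: Ruelle1969, §3.4]
* R. B. Israel, *Convexity in the Theory of Lattice Gases* (1979), Lemma II.3.1. [cite: Israel1979, Lemma II.3.1]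
-/

noncomputable section

namespace Literature.MathematicalPhysics.QuantumLattice

open Matrix Finset HubbardWave0 ThermodynamicLimit LiebThm1
open scoped ComplexOrder BigOperators

section GrandCanonical

variable {Λ : Type*} [LinearOrder Λ] [Fintype Λ]

/-- **Canonical ≤ grand-canonical**: for a Hermitian sector-preserving `A`, real `β, μ` and a spin sector
`(a, b)`, `e^{βμ(a+b)} · Re Z_β(A; a, b) ≤ Re Z_β(A − μN)` (Peierls' inequality for the orthonormal sector
eigenbasis of `A`, whose members are `(a+b)`-particle vectors: `⟨ψ_c, (A − μN)ψ_c⟩ = λ_c − μ(a+b)`).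
[cite: Ruelle1969, §3.4] -/
theorem exp_mul_partitionFn_spinSector_le_grandCanonical {A : Matrix (Finset (Orb Λ)) (Finset (Orb Λ)) ℂ}
    (hA : A.IsHermitian) (hP : PreservesSectors A) (β μ : ℝ) (a b : ℕ) :
    Real.exp (β * μ * (a + b)) * (partitionFn β (spinSectorHamiltonian a b A)).re ≤
      (partitionFn β (A - (μ : ℂ) • totalNumber)).re := by
  have hK : (A - (μ : ℂ) • totalNumber).IsHermitian :=
    hA.sub (totalNumber_isHermitian.smul (by rw [isSelfAdjoint_iff, Complex.star_def, Complex.conj_ofReal]))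
  have hinv : ∀ s s', ¬ spinConfig (Λ := Λ) a b s → spinConfig (Λ := Λ) a b s' → A s s' = 0 :=
    fun s s' hs hs' => apply_eq_zero_of_preservesSectors hP a b s s' hs hs'
  have hon : ∀ c c', star (sectorEigenvector (spinConfig (Λ := Λ) a b) A hA c) ⬝ᵥ
      sectorEigenvector (spinConfig (Λ := Λ) a b) A hA c' = if c = c' then 1 else 0 :=
    fun c c' => star_sectorEigenvector_dotProduct _ A hA c c'
  have hsec : ∀ c, IsInSector a b (sectorEigenvector (spinConfig (Λ := Λ) a b) A hA c) :=
    fun c s hs => sectorEigenvector_apply_of_not_mem (spinConfig (Λ := Λ) a b) A hA c hs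
  have hE : ∀ c, (star (sectorEigenvector (spinConfig (Λ := Λ) a b) A hA c) ⬝ᵥ
      ((A - (μ : ℂ) • totalNumber) *ᵥ sectorEigenvector (spinConfig (Λ := Λ) a b) A hA c)).re =
      sectorEigenvalue (spinConfig (Λ := Λ) a b) A hA c - μ * (a + b) := by
    intro c
    have hu : star (sectorEigenvector (spinConfig (Λ := Λ) a b) A hA c) ⬝ᵥ
        sectorEigenvector (spinConfig (Λ := Λ) a b) A hA c = 1 := by rw [hon, if_pos rfl]
    rw [sub_mulVec, dotProduct_sub, Complex.sub_re, re_rayleigh_sectorEigenvector _ hA hinv c, smul_mulVec,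
      totalNumber_mulVec_of_isNParticle (hsec c).isNParticle, smul_smul, dotProduct_smul, hu, smul_eq_mul,
      mul_one, ← Complex.ofReal_natCast, ← Complex.ofReal_mul, Complex.ofReal_re]
    push_cast
    ring
  have hPe := hK.sum_exp_neg_mul_rayleigh_le_partitionFn β hon
  simp only [hE] at hPe
  rw [partitionFn_spinSectorHamiltonian_re a b hA, Finset.mul_sum]
  refine le_of_eq_of_le (Finset.sum_congr rfl fun c _ => ?_) hPe
  rw [← Real.exp_add]
  congr 1
  ring

/-- **Logarithmic form** (nonempty sector): `log Re Z_β(A; a, b) ≤ log Re Z_β(A − μN) − βμ(a+b)`.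
[cite: Ruelle1969, §3.4] -/
theorem log_partitionFn_spinSector_le_grandCanonical {a b : ℕ} [Nonempty (Subtype (spinConfig (Λ := Λ) a b))]
    {A : Matrix (Finset (Orb Λ)) (Finset (Orb Λ)) ℂ} (hA : A.IsHermitian) (hP : PreservesSectors A)
    (β μ : ℝ) :
    Real.log (partitionFn β (spinSectorHamiltonian a b A)).re ≤
      Real.log (partitionFn β (A - (μ : ℂ) • totalNumber)).re - β * μ * (a + b) := by
  have hpos : 0 < (partitionFn β (spinSectorHamiltonian a b A)).re := partitionFn_spinSector_re_pos hA β
  have h := exp_mul_partitionFn_spinSector_le_grandCanonical hA hP β μ a b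
  have hlog := Real.log_le_log (mul_pos (Real.exp_pos _) hpos) h
  rw [Real.log_mul (Real.exp_pos _).ne' hpos.ne', Real.log_exp] at hlog
  linarith

end GrandCanonical

/-! ### The torus-limit thermal convention -/

section Torus

/-- **Canonical ≤ grand-canonical on the torus** (thermal convention of `TorusSectorGibbsEnergyWindow`): for
`0 ≤ n ≤ 2`, every real `β, μ`:
`log Re Z_β(sectorHamiltonianTT' t t' U n L) ≤ log Re Z_β(hubbardTorusTT' L t t' U − μN) − βμ · rectN n L` —
any certified upper bound on the grand-canonical log-partition function of the torus (at any chemical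
potential) yields the hypothesis `huh` of the hot chord. [cite: Ruelle1969, §3.4] -/
theorem log_partitionFn_sectorHamiltonianTT'_le_grandCanonical (t t' U : ℝ) {n : ℝ} (hn0 : 0 ≤ n)
    (hn2 : n ≤ 2) (L : ℕ) (β μ : ℝ) :
    Real.log (partitionFn β (sectorHamiltonianTT' t t' U n L)).re ≤
      Real.log (partitionFn β (hubbardTorusTT' L t t' U - (μ : ℂ) • totalNumber)).re -
        β * μ * (rectN n L : ℕ) := by
  haveI : Nonempty (Subtype (spinConfig (Λ := FermionTorus 2 L) (halfRectN n L) (halfRectN n L))) :=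
    nonempty_szConfig hn0 hn2 L
  have hP : PreservesSectors (hubbardTorusTT' L t t' U) :=
    LiebTwoHoppings.preservesSectors_hamiltonian₂ (fermionTorusGraph 2 L) (fermionTorusDiagGraph L) t t' U
  have h := log_partitionFn_spinSector_le_grandCanonical (hubbardTorusTT'_isHermitian L t t' U) hP β μ
    (a := halfRectN n L) (b := halfRectN n L)
  rw [partitionFn_sectorHamiltonianTT'_eq_spinSector]
  have hN : ((rectN n L : ℕ) : ℝ) = (halfRectN n L : ℝ) + (halfRectN n L : ℝ) := by
    rw [show rectN n L = 2 * halfRectN n L from rfl]; push_cast; ring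
  rw [hN]
  -- the grand-canonical side carries the decidability instance of `Finset (Orb (FermionTorus 2 L))`
  -- synthesised here, the generic lemma the one derived from the linear order: equal as subsingletons
  convert h using 4
  congr!

end Torus

end Literature.MathematicalPhysics.QuantumLattice
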